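import Literature.MathematicalPhysics.StatisticalMechanics.BarlowCoordination
import Literature.MathematicalPhysics.StatisticalMechanics.BarlowRings

/-!
# `StackingHinge` (stmt-AtomisticToContinuum-14993), line `Sketch`: stub `stub_barlowSecondShellGap`

The second coordination shell of an ideal Barlow stacking sits at `√2 · a`: in
`barlowStacking a (a√(2/3)) s` (`a > 0`, `s` a Hägg sequence) two points at squared distance
`< 2a²` coincide or are at distance exactly `a`.

Proof. This is the distance gap `(a, √2·a)` of `BarlowRings.eq_or_dist_eq_of_dist_lt`
(the twelve-coordination form `12 · dist² = a² · (3(2P+Q+Λ)² + (3Q+Λ)² + 8K²)` of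
`BarlowCoordination.twelve_mul_dist_barlowPos_sq` takes no integer value strictly between `12`
and `24`), at the ideal layer spacing `h = a√(2/3)` (`h² = ⅔a²`), after converting the squared
hypothesis `dist² < 2a²` into `dist < √2 · a`.
-/

noncomputable section

namespace Summit.AtomisticToContinuum.Crystallization.Theorems.PricedHcpWindowsSecondShellGap

open Literature.MathematicalPhysics.StatisticalMechanics

/-- **Stub `stub_barlowSecondShellGap` of line `Sketch`: the second shell of an ideal Barlow
stacking is at `√2 · a`.** For `a > 0` and a Hägg sequence `s`, two points of
`barlowStacking a (a√(2/3)) s` at squared distance `< 2a²` coincide or are at distance exactly `a`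
(the distance gap `(a, √2·a)` of `BarlowRings.eq_or_dist_eq_of_dist_lt`, at `h = a√(2/3)`,
`h² = ⅔a²`, with `dist² < 2a² ⇒ dist < √2·a`).
[cite: HalesDSP2012, §1.3] -/
theorem stub_barlowSecondShellGap : (∀ (a : ℝ) (s : ℤ → ℤ), 0 < a → Literature.MathematicalPhysics.StatisticalMechanics.IsHaggSeq s → ∀ z ∈ Literature.MathematicalPhysics.StatisticalMechanics.barlowStacking a (a * Real.sqrt (2 / 3)) s, ∀ z' ∈ Literature.MathematicalPhysics.StatisticalMechanics.barlowStacking a (a * Real.sqrt (2 / 3)) s, dist z z' ^ 2 < 2 * a ^ 2 → z = z' ∨ dist z z' = a) := by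
  intro a s ha hs z hz z' hz' hlt
  -- the ideal layer spacing: `h² = ⅔ a²`
  have hh : (a * Real.sqrt (2 / 3)) ^ 2 = 2 / 3 * a ^ 2 := by
    rw [mul_pow, Real.sq_sqrt (by norm_num : (0 : ℝ) ≤ 2 / 3)]; ring
  -- `dist² < 2a²` ⇒ `dist < √2 · a`
  have h2 : (Real.sqrt 2 * a) ^ 2 = 2 * a ^ 2 := by
    rw [mul_pow, Real.sq_sqrt (by norm_num : (0 : ℝ) ≤ 2)]
  have hd : dist z z' < Real.sqrt 2 * a :=
    lt_of_pow_lt_pow_left₀ 2 (by positivity) (by rw [h2]; exact hlt)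
  exact eq_or_dist_eq_of_dist_lt hs ha hh hz hz' hd

end Summit.AtomisticToContinuum.Crystallization.Theorems.PricedHcpWindowsSecondShellGap

end
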